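import Literature.Computability.AlgebraicComplexity.GraphTensorOddCycles
import Literature.Computability.AlgebraicComplexity.GraphTensorTriangle
import Literature.Computability.AlgebraicComplexity.PolarizationIdentity
import HarnessLib

/-!
# Tensor surgery on cycles: `R(T_n(C_{k+2})) ≤ R(T_n(C_k)) · R(T_n(C_3))`, hence `ω(T(C_k)) ≤ (k−1)/2 · ω` for odd `k`
# (Christandl–Zuiddam 2018, Thm. 3.5 / Cor. 3.6; Christandl–Vrana–Zuiddam 2019, Thm. 1.1.24) — and the DISCHARGE
# `cvz19_thm_1_1_24_holds` of the named fact `cvz19_thm_1_1_24` (`GraphTensor.lean`)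

Topic `Literature/Computability/AlgebraicComplexity`, sequel of `GraphTensorOddCycles.lean` (odd lower bound),
`GraphTensorFlattening.lean` (even cycles) and `GraphTensorTriangle.lean` (`T(K_3) = ⟨n,n,n⟩`, `ω(T(K_3)) = ω`).
Everything here is PROVED; no named fact is introduced, one is discharged.

## What is printed

[CZ18] Christandl–Zuiddam, *Tensor surgery and tensor rank*, Comput. Complexity 28 (2019) 27–56 = arXiv:1606.04085,
§3.2, Thm. 3.5: "For `k, ℓ` odd, `ω_{k+ℓ−1} ≤ ω_k + ω_ℓ`" [`ω_k := ω(T(C_k))`], with the proof: "Let `φ` be the linear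
map `ℂⁿ ⊗ ℂⁿ → (ℂⁿ ⊗ ℂⁿ)^{⊗ℓ}` defined on simple tensors by `u ⊗ v ↦ ∑_{j ∈ [n]^{ℓ−1}} (u ⊗ b_{j₁}) ⊗ (b_{j₁} ⊗ b_{j₂})
⊗ ⋯ ⊗ (b_{j_{ℓ−1}} ⊗ v)`, and let `ψ` be the linear map … that applies `φ` at the first tensor leg.  Then
`T_n(C_{k+ℓ−1}) = ψ(T_n(C_k))`. … Consider one simple summand `t¹ ⊗ ⋯ ⊗ t^k` in this decomposition. We have
`rank_{ℂⁿ⊗ℂⁿ}(t¹) ≤ n` and hence `φ(t¹) ≤ T_n(C_ℓ)`. The rank of `ψ(t¹ ⊗ ⋯ ⊗ t^k)` is therefore at most [the rank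
of `T_n(C_ℓ)`]"; Cor. 3.6: "Let `k ≥ 5` odd. Then `ω_k ≤ ω_{k−2} + ω_3` and thus `ω_k ≤ (k−1)/2 · ω`."
[CVZ19] Christandl–Vrana–Zuiddam, arXiv:1609.07476, Thm. 1.1.24 (p. 7): "Let `k ∈ ℕ_{≥1}`. Then `ω(T(C_k)) = k`
when `k` is even, `k − 1 ≤ ω(T(C_k)) ≤ (k−1)/2 · ω` when `k` is odd"; Ex. 1.1.2: "`T_n(C_3)` is … `⟨n,n,n⟩`".

## How it is typed (the printed proof with `ℓ = 3`, in coordinates, every field `F`)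

* §0 `reindex`: pre-composition of a tensor with maps of the leg index sets sends rank-one tensors to rank-one
  tensors, so `R` does not increase (`tensorRankD_reindex_le`) and is invariant under leg-wise bijections
  (`tensorRankD_reindex_equiv`) — [CVZ19] after Def. 1.1.1 ("tensor rank … do[es] not depend on this order").
* §1 `T_n(C_3)` is `T_n(K_3)` of `GraphTensorTriangle.lean` up to renaming the edges and swapping the two slots of
  one leg (`graphTensor_cycleSlots_three`), so `R(T_n(C_3)) = R(⟨n,n,n⟩)` and **`ω(T(C_3)) = ω`**
  (`graphOmega_cycleSlots_three`); `T_n(C_1)` is a one-leg tensor, `R ≤ 1`, **`ω(T(C_1)) = 0`**.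
* §2 the surgery map with `ℓ = 3` in coordinates: `surgery S T (i) = ∑_{c ∈ [n]} S(i') · T(j')`, where the old legs
  `0, …, m−1` keep their pair labels, the split leg `m` of `C_{m+1}` reads `(c, y_m)`, and the triangle legs read
  `(x_m, c), i_{m+1}, i_{m+2}` (`c` = the label of the contracted edge).  It is additive in both arguments, sends
  (rank-one) ⊗ (rank-one) to ONE rank-one tensor (`surgery_rankOneTensor` — this is "`φ(t¹) ≤ T_n(C_3)`" applied
  to a rank-one summand of `T_n(C_3)`), and `surgery (T_n(C_{m+1})) (T_n(C_3)) = T_n(C_{m+3})`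
  (`surgery_graphTensor` — this is "`T_n(C_{k+2}) = ψ(T_n(C_k))`").  Hence
  **`R(T_n(C_{m+3})) ≤ R(T_n(C_{m+1})) · R(T_n(C_3))`** (`tensorRankD_cycleSlots_surgery_le`, Thm. 3.5 with `ℓ = 3`
  at the level of ranks) and `R(T_n(C_{2j+1})) ≤ R(T_n(C_3))^j`.
* §3 exponents: `ω(T(C_{2j+1})) ≤ j · ω(T(C_3)) = j · ω` (`graphOmega_cycleSlots_odd_le`, Cor. 3.6), the odd upper
  bound of [CVZ19] Thm. 1.1.24 (`graphOmega_cycleSlots_le_of_odd`), and the discharge **`cvz19_thm_1_1_24_holds`**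
  assembling `cvz19_thm_1_1_24_even` (`GraphTensorFlattening.lean`), `cvz19_thm_1_1_24_odd_lower`
  (`GraphTensorOddCycles.lean`) and the upper bound.

No `sorry`, no axiom, no instance, no notation, no `Prop`-valued definition.

## References

* [CZ18] M. Christandl, J. Zuiddam, Tensor surgery and tensor rank, Comput. Complexity 28 (2019), §3.2 Thm. 3.5,
  Cor. 3.6.  [ChristandlZuiddam2018]
* [CVZ19] Christandl–Vrana–Zuiddam, arXiv:1609.07476, Ex. 1.1.2, Thm. 1.1.24.  [ChristandlVranaZuiddam2016]
-/

noncomputable section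

open scoped BigOperators
open Filter Asymptotics

namespace Literature.Computability.AlgebraicComplexity

/-! ## §0 Re-indexing the legs does not increase tensor rank -/

section Reindex

variable {F : Type*} [Field F] {k N N' : ℕ}

/-- Pre-composition of a `k`-leg tensor with maps `π_v` of the leg index sets: `(reindex π T)(i) = T(π ∘ i)`
(coordinate form of applying the linear maps `b_x ↦ ∑_{π_v x' = x} b_{x'}` leg-wise). [cite: ChristandlVranaZuiddam2016, Def. 1.1.1] -/
def reindex (π : Fin k → Fin N' → Fin N) (T : (Fin k → Fin N) → F) : (Fin k → Fin N') → F :=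
  fun i => T fun v => π v (i v)

omit [Field F] in
/-- Unfolding lemma. [cite: ChristandlVranaZuiddam2016, Def. 1.1.1] -/
theorem reindex_apply (π : Fin k → Fin N' → Fin N) (T : (Fin k → Fin N) → F) (i : Fin k → Fin N') :
    reindex π T i = T fun v => π v (i v) := rfl

/-- Re-indexing a rank-one tensor gives the rank-one tensor of the re-indexed legs. [cite: ChristandlVranaZuiddam2016, Def. 1.1.1] -/
theorem reindex_rankOneTensor (π : Fin k → Fin N' → Fin N) (u : Fin k → Fin N → F) :
    reindex π (rankOneTensor u) = rankOneTensor fun v => u v ∘ π v := rfl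

/-- Re-indexing is additive over finite sums. [cite: ChristandlVranaZuiddam2016, Def. 1.1.1] -/
theorem reindex_sum {ι : Type*} (s : Finset ι) (π : Fin k → Fin N' → Fin N) (T : ι → (Fin k → Fin N) → F) :
    reindex π (∑ t ∈ s, T t) = ∑ t ∈ s, reindex π (T t) := by
  funext i
  simp only [reindex_apply, Finset.sum_apply]

/-- **Re-indexing does not increase tensor rank** (a rank-one decomposition is carried to one of the same
length). [cite: ChristandlVranaZuiddam2016, Def. 1.1.1] -/
theorem tensorRankD_reindex_le [NeZero k] (π : Fin k → Fin N' → Fin N) (T : (Fin k → Fin N) → F) :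
    tensorRankD (reindex π T) ≤ tensorRankD T := by
  obtain ⟨u, hu⟩ := exists_sum_rankOneTensor_eq_of_tensorRankD_le (le_refl (tensorRankD T))
  refine tensorRankD_le_of_eq_sum (fun t v => u t v ∘ π v) ?_
  rw [show reindex π T = reindex π (∑ t, rankOneTensor (u t)) by rw [hu], reindex_sum]
  rfl

/-- Re-indexing along leg-wise BIJECTIONS preserves tensor rank ("tensor rank … do[es] not depend on this
order"). [cite: ChristandlVranaZuiddam2016, Def. 1.1.1] -/
theorem tensorRankD_reindex_equiv [NeZero k] (π : Fin k → Fin N' ≃ Fin N) (T : (Fin k → Fin N) → F) :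
    tensorRankD (reindex (fun v => π v) T) = tensorRankD T := by
  refine le_antisymm (tensorRankD_reindex_le _ T) ?_
  have h := tensorRankD_reindex_le (fun v => ((π v).symm : Fin N → Fin N')) (reindex (fun v => π v) T)
  have hT : reindex (fun v => ((π v).symm : Fin N → Fin N')) (reindex (fun v => π v) T) = T := by
    funext i
    simp only [reindex_apply, Equiv.apply_symm_apply]
  rwa [hT] at h

end Reindex

/-! ## §1 Pair labels; the entries of `T_n(C_k)`; `T(C_3) = T(K_3)` up to slots; `T(C_1)` -/

section CycleEntries

variable (F : Type*) [Field F]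

/-- The first pair label `x` of a leg index `p = (x, y) ∈ [n]²` of a cycle tensor (slot `0`, the edge to the NEXT
vertex). [cite: ChristandlVranaZuiddam2016, Ex. 1.1.2] -/
def fstLabel (n : ℕ) (p : Fin (n ^ 2)) : Fin n := ((pairIndex n).symm p).1

/-- The second pair label `y` of a leg index `p = (x, y)` (slot `1`, the edge to the PREVIOUS vertex).
[cite: ChristandlVranaZuiddam2016, Ex. 1.1.2] -/
def sndLabel (n : ℕ) (p : Fin (n ^ 2)) : Fin n := ((pairIndex n).symm p).2

variable {F}

/-- `x(pair(a, b)) = a`. [cite: ChristandlVranaZuiddam2016, Ex. 1.1.2] -/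
@[simp] theorem fstLabel_pairIndex {n : ℕ} (a b : Fin n) : fstLabel n (pairIndex n (a, b)) = a := by
  simp [fstLabel]

/-- `y(pair(a, b)) = b`. [cite: ChristandlVranaZuiddam2016, Ex. 1.1.2] -/
@[simp] theorem sndLabel_pairIndex {n : ℕ} (a b : Fin n) : sndLabel n (pairIndex n (a, b)) = b := by
  simp [sndLabel]

/-- `pair(x(p), y(p)) = p`. [cite: ChristandlVranaZuiddam2016, Ex. 1.1.2] -/
@[simp] theorem pairIndex_fstLabel_sndLabel {n : ℕ} (p : Fin (n ^ 2)) :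
    pairIndex n (fstLabel n p, sndLabel n p) = p := by
  simp [fstLabel, sndLabel]

/-- The leg index of `T_n(C_k)` at vertex `v` for the labelling `l` is the pair `(l(v), l(v − 1))` (edge `v` to the
next vertex, edge `v − 1` to the previous one). [cite: ChristandlVranaZuiddam2016, Ex. 1.1.2] -/
theorem slotIndex_cycleSlots {k : ℕ} [NeZero k] {n : ℕ} (l : Fin k → Fin n) (v : Fin k) :
    slotIndex (cycleSlots k) l v = pairIndex n (l v, l (v - 1)) := by
  show finFunctionFinEquiv _ = finFunctionFinEquiv _
  congr 1
  funext j
  fin_cases j <;> rfl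

/-- **Entries of `T_n(C_k)`**: the entry at `i = ((x_v, y_v))_v` is `1` if `x_e = y_{e+1}` for every edge `e`
(the label of the edge `e` read at both its ends), else `0` (CVZ19 Ex. 1.1.2:
`T_n(C_5) = ∑_{i ∈ [n]^5} b_{i₁i₂} ⊗ b_{i₂i₃} ⊗ b_{i₃i₄} ⊗ b_{i₄i₅} ⊗ b_{i₅i₁}`). [cite: ChristandlVranaZuiddam2016, Ex. 1.1.2] -/
theorem graphTensor_cycleSlots_apply {k : ℕ} [NeZero k] (n : ℕ) (i : Fin k → Fin (n ^ 2)) :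
    graphTensor F (cycleSlots k) n i =
      if ∀ e : Fin k, fstLabel n (i e) = sndLabel n (i (e + 1)) then 1 else 0 := by
  classical
  rw [graphTensor_apply_of_covering (cycleSlots_covering k)]
  have hiff : (∃ l : Fin k → Fin n, slotIndex (cycleSlots k) l = i) ↔
      ∀ e : Fin k, fstLabel n (i e) = sndLabel n (i (e + 1)) := by
    constructor
    · rintro ⟨l, rfl⟩ e
      rw [slotIndex_cycleSlots, slotIndex_cycleSlots, fstLabel_pairIndex, sndLabel_pairIndex, add_sub_cancel_right]
    · intro h
      refine ⟨fun v => fstLabel n (i v), funext fun v => ?_⟩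
      rw [slotIndex_cycleSlots]
      have hv := h (v - 1)
      rw [sub_add_cancel] at hv
      rw [hv, pairIndex_fstLabel_sndLabel]
  exact if_congr hiff rfl rfl

/-- The cycle `C_3` with its edges renamed into those of `triangleSlots` (`01 ↦ 0`, `12 ↦ 2`, `20 ↦ 1`) reads, at
vertex `1`, the two triangle slots in the swapped order. [cite: ChristandlVranaZuiddam2016, Ex. 1.1.2] -/
theorem cycleSlots_three_relabel :
    (fun v j => (Equiv.swap (1 : Fin 3) 2) (cycleSlots 3 v j)) = ![![0, 1], ![2, 0], ![1, 2]] := by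
  funext v j
  fin_cases v <;> fin_cases j <;> rfl

/-- The slot swap at vertex `1`: the leg-wise bijection `(x, y) ↦ (y, x)` on leg `1`, identity on legs `0, 2`.
[cite: ChristandlVranaZuiddam2016, Ex. 1.1.2] -/
def swapMiddle (n : ℕ) : Fin 3 → Fin (n ^ 2) ≃ Fin (n ^ 2) :=
  ![Equiv.refl _, ((pairIndex n).symm.trans (Equiv.prodComm _ _)).trans (pairIndex n), Equiv.refl _]

/-- **`T_n(C_3)` is `T_n(K_3)` with the slots of leg `1` swapped** (and the edges renamed).
[cite: ChristandlVranaZuiddam2016, Ex. 1.1.2] -/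
theorem graphTensor_cycleSlots_three (n : ℕ) :
    graphTensor F (cycleSlots 3) n = reindex (fun v => swapMiddle n v) (graphTensor F triangleSlots n) := by
  classical
  rw [← graphTensor_relabel (Equiv.swap (1 : Fin 3) 2) (cycleSlots 3) n, cycleSlots_three_relabel]
  funext i
  rw [reindex_apply, graphTensor_apply_of_covering (by decide), graphTensor_apply_of_covering triangleSlots_covering]
  have vec3 : ∀ (a b c : Fin (n ^ 2)) (f : Fin 3 → Fin (n ^ 2)), (![a, b, c] = f) ↔ (a = f 0 ∧ b = f 1 ∧ c = f 2) :=
    fun a b c f => ⟨fun h => ⟨congrFun h 0, congrFun h 1, congrFun h 2⟩, fun h => by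
      funext v
      fin_cases v
      exacts [h.1, h.2.1, h.2.2]⟩
  have mid : ∀ (a b : Fin n) (p : Fin (n ^ 2)), pairIndex n (a, b) = swapMiddle n 1 p ↔ pairIndex n (b, a) = p := by
    intro a b p
    have e1 : swapMiddle n 1 p = pairIndex n ((pairIndex n).symm p).swap := rfl
    rw [e1, (pairIndex n).injective.eq_iff]
    constructor
    · intro h
      have h' : ((pairIndex n).symm p) = (b, a) := by
        rw [← Prod.swap_swap ((pairIndex n).symm p), ← h]
        rfl
      rw [← h', Equiv.apply_symm_apply]
    · rintro rfl
      rw [Equiv.symm_apply_apply]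
      rfl
  have key : ∀ l : Fin 3 → Fin n,
      (slotIndex (![![0, 1], ![2, 0], ![1, 2]] : Fin 3 → Fin 2 → Fin 3) l = i) ↔
        (slotIndex triangleSlots l = fun v => swapMiddle n v (i v)) := by
    intro l
    rw [slotIndex_triangleSlots]
    have h1 : slotIndex (![![0, 1], ![2, 0], ![1, 2]] : Fin 3 → Fin 2 → Fin 3) l =
        ![pairIndex n (l 0, l 1), pairIndex n (l 2, l 0), pairIndex n (l 1, l 2)] := by
      funext v
      fin_cases v <;>
      · show finFunctionFinEquiv _ = finFunctionFinEquiv _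
        congr 1
        funext j
        fin_cases j <;> rfl
    rw [h1, vec3, vec3, mid]
    rfl
  simp only [key]

/-- **`R(T_n(C_3)) = R(⟨n,n,n⟩)`** (CVZ19 Ex. 1.1.2: "`T_n(C_3)` is called the `n × n` matrix multiplication
tensor"). [cite: ChristandlVranaZuiddam2016, Ex. 1.1.2] -/
theorem tensorRankD_cycleSlots_three (n : ℕ) :
    tensorRankD (graphTensor F (cycleSlots 3) n) = tensorRank (matMulTensor F n n n) := by
  rw [graphTensor_cycleSlots_three, tensorRankD_reindex_equiv, tensorRankD_triangle_eq]

variable (F)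

/-- `T(C_3)` and `T(K_3)` have the same admissible exponents. [cite: ChristandlVranaZuiddam2016, Def. 1.1.22] -/
theorem graphExponents_cycleSlots_three : graphExponents F (cycleSlots 3) = graphExponents F triangleSlots := by
  ext β
  simp only [mem_graphExponents_iff, tensorRankD_cycleSlots_three, tensorRankD_triangle_eq]

/-- **`ω(T(C_3)) = ω`** (CVZ19 Def. 1.1.22: "`ω := ω(T(C_3))`"). [cite: ChristandlVranaZuiddam2016, Def. 1.1.22] -/
theorem graphOmega_cycleSlots_three : graphOmega F (cycleSlots 3) = omega F := by
  unfold graphOmega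
  rw [graphExponents_cycleSlots_three]
  exact graphOmega_triangleSlots F

variable {F}

/-- A one-leg tensor has rank `≤ 1` (it is its own single leg). [cite: ChristandlVranaZuiddam2016, Def. 1.1.1] -/
theorem tensorRankD_le_one_of_one_leg {N : ℕ} (T : (Fin 1 → Fin N) → F) : tensorRankD T ≤ 1 := by
  refine tensorRankD_le_of_eq_sum (fun _ _ x => T fun _ => x) ?_
  rw [Fin.sum_univ_one]
  funext i
  rw [rankOneTensor_apply, Fin.prod_univ_one]
  congr 1
  funext v
  rw [Subsingleton.elim v 0]

/-- `R(T_n(C_1)) ≤ 1`. [cite: ChristandlVranaZuiddam2016, Thm. 1.1.24] -/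
theorem tensorRankD_cycleSlots_one_le (n : ℕ) : tensorRankD (graphTensor F (cycleSlots 1) n) ≤ 1 :=
  tensorRankD_le_one_of_one_leg _

variable (F)

/-- **`ω(T(C_1)) = 0`** (the case `k = 1` of CVZ19 Thm. 1.1.24: `0 ≤ ω(T(C_1)) ≤ 0 · ω`).
[cite: ChristandlVranaZuiddam2016, Thm. 1.1.24] -/
theorem graphOmega_cycleSlots_one : graphOmega F (cycleSlots 1) = 0 := by
  refine le_antisymm (graphOmega_le_of_mem (cycleSlots_covering 1) ?_) (graphOmega_nonneg (cycleSlots_covering 1))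
  refine IsBigO.of_bound 1 (Eventually.of_forall fun n => ?_)
  rw [Real.rpow_zero, one_mul, norm_one, Real.norm_of_nonneg (Nat.cast_nonneg _)]
  exact_mod_cast tensorRankD_cycleSlots_one_le (F := F) n

end CycleEntries

/-! ## §2 The surgery map `C_{m+1} + C_3 ⟶ C_{m+3}` in coordinates ([CZ18] Thm. 3.5 with `ℓ = 3`) -/

section Surgery

variable {F : Type*} [Field F] {m n : ℕ}

/-- The leg indices of `T_n(C_{m+1})` entering the surgery sum at the contracted label `c`: the old legs
`e < m` keep the pair labels of leg `e` of `C_{m+3}`, the split leg `m` reads `(c, y_m)`.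
[cite: ChristandlZuiddam2018, Thm. 3.5] -/
def surgeryOld (n : ℕ) (i : Fin (m + 3) → Fin (n ^ 2)) (c : Fin n) : Fin (m + 1) → Fin (n ^ 2) :=
  fun e => pairIndex n
    (if e = Fin.last m then c else fstLabel n (i (Fin.castSucc (Fin.castSucc e))),
      sndLabel n (i (Fin.castSucc (Fin.castSucc e))))

/-- The leg indices of `T_n(C_3)` entering the surgery sum: `(x_m, c)`, `i_{m+1}`, `i_{m+2}`.
[cite: ChristandlZuiddam2018, Thm. 3.5] -/
def surgeryTri (n : ℕ) (i : Fin (m + 3) → Fin (n ^ 2)) (c : Fin n) : Fin 3 → Fin (n ^ 2) :=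
  ![pairIndex n (fstLabel n (i (Fin.castSucc (Fin.castSucc (Fin.last m)))), c),
    i (Fin.castSucc (Fin.last (m + 1))), i (Fin.last (m + 2))]

/-- **The surgery map `ψ` with `ℓ = 3`, in coordinates**: `(surgery S T)(i) = ∑_{c ∈ [n]} S(surgeryOld i c) ·
T(surgeryTri i c)` — split the leg `m` of an `(m+1)`-leg tensor, insert the two new legs `m+1, m+2`, and contract
the label `c` of the new edge `{m+2, 0}` against a `3`-leg tensor. [cite: ChristandlZuiddam2018, Thm. 3.5] -/
def surgery (S : (Fin (m + 1) → Fin (n ^ 2)) → F) (T : (Fin 3 → Fin (n ^ 2)) → F) :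
    (Fin (m + 3) → Fin (n ^ 2)) → F :=
  fun i => ∑ c : Fin n, S (surgeryOld n i c) * T (surgeryTri n i c)

/-- The legs of `ψ(w_0 ⊗ ⋯ ⊗ w_m)` decomposed along a rank-one summand `u_0 ⊗ u_1 ⊗ u_2` of `T_n(C_3)`: the old
legs `w_e` (`e < m`), the leg `p = (x, y) ↦ ∑_c w_m(c, y) · u_0(x, c)` (the image of `u_0` under the linear map
defined by the matrix `w_m`), and the legs `u_1, u_2`. [cite: ChristandlZuiddam2018, Thm. 3.5] -/
def surgeryLeg (w : Fin (m + 1) → Fin (n ^ 2) → F) (u : Fin 3 → Fin (n ^ 2) → F) :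
    Fin (m + 3) → Fin (n ^ 2) → F :=
  Fin.snoc (α := fun _ => Fin (n ^ 2) → F)
    (Fin.snoc (α := fun _ => Fin (n ^ 2) → F)
      (Fin.snoc (α := fun _ => Fin (n ^ 2) → F) (fun e => w (Fin.castSucc e))
        (fun p => ∑ c : Fin n, w (Fin.last m) (pairIndex n (c, sndLabel n p)) *
          u 0 (pairIndex n (fstLabel n p, c))))
      (u 1))
    (u 2)

/-- Unfolding lemma. [cite: ChristandlZuiddam2018, Thm. 3.5] -/
theorem surgery_apply (S : (Fin (m + 1) → Fin (n ^ 2)) → F) (T : (Fin 3 → Fin (n ^ 2)) → F)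
    (i : Fin (m + 3) → Fin (n ^ 2)) :
    surgery S T i = ∑ c : Fin n, S (surgeryOld n i c) * T (surgeryTri n i c) := rfl

/-- The old legs `e < m` keep their indices. [cite: ChristandlZuiddam2018, Thm. 3.5] -/
theorem surgeryOld_castSucc (i : Fin (m + 3) → Fin (n ^ 2)) (c : Fin n) (e : Fin m) :
    surgeryOld n i c (Fin.castSucc e) = i (Fin.castSucc (Fin.castSucc (Fin.castSucc e))) := by
  simp only [surgeryOld, (Fin.castSucc_lt_last e).ne, if_false, pairIndex_fstLabel_sndLabel]

/-- The split leg reads `(c, y_m)`. [cite: ChristandlZuiddam2018, Thm. 3.5] -/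
theorem surgeryOld_last (i : Fin (m + 3) → Fin (n ^ 2)) (c : Fin n) :
    surgeryOld n i c (Fin.last m) = pairIndex n (c, sndLabel n (i (Fin.castSucc (Fin.castSucc (Fin.last m))))) := by
  simp only [surgeryOld, if_true]

/-- Triangle leg `0` reads `(x_m, c)`. [cite: ChristandlZuiddam2018, Thm. 3.5] -/
theorem surgeryTri_zero (i : Fin (m + 3) → Fin (n ^ 2)) (c : Fin n) :
    surgeryTri n i c 0 = pairIndex n (fstLabel n (i (Fin.castSucc (Fin.castSucc (Fin.last m)))), c) := rfl

/-- Triangle leg `1` reads `i_{m+1}`. [cite: ChristandlZuiddam2018, Thm. 3.5] -/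
theorem surgeryTri_one (i : Fin (m + 3) → Fin (n ^ 2)) (c : Fin n) :
    surgeryTri n i c 1 = i (Fin.castSucc (Fin.last (m + 1))) := rfl

/-- Triangle leg `2` reads `i_{m+2}`. [cite: ChristandlZuiddam2018, Thm. 3.5] -/
theorem surgeryTri_two (i : Fin (m + 3) → Fin (n ^ 2)) (c : Fin n) :
    surgeryTri n i c 2 = i (Fin.last (m + 2)) := rfl

/-- `ψ` is additive in the tensor it cuts open. [cite: ChristandlZuiddam2018, Thm. 3.5] -/
theorem surgery_sum_left {ι : Type*} (s : Finset ι) (S : ι → (Fin (m + 1) → Fin (n ^ 2)) → F)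
    (T : (Fin 3 → Fin (n ^ 2)) → F) : surgery (∑ a ∈ s, S a) T = ∑ a ∈ s, surgery (S a) T := by
  funext i
  simp only [surgery_apply, Finset.sum_apply, Finset.sum_mul]
  rw [Finset.sum_comm]

/-- `ψ` is additive in the inserted tensor. [cite: ChristandlZuiddam2018, Thm. 3.5] -/
theorem surgery_sum_right {ι : Type*} (s : Finset ι) (S : (Fin (m + 1) → Fin (n ^ 2)) → F)
    (T : ι → (Fin 3 → Fin (n ^ 2)) → F) : surgery S (∑ b ∈ s, T b) = ∑ b ∈ s, surgery S (T b) := by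
  funext i
  simp only [surgery_apply, Finset.sum_apply, Finset.mul_sum]
  rw [Finset.sum_comm]

/-- **"`φ(t¹) ≤ T_n(C_3)`", summand by summand: the surgery of a rank-one tensor against a rank-one tensor is ONE
rank-one tensor**, with legs `surgeryLeg`. [cite: ChristandlZuiddam2018, Thm. 3.5] -/
theorem surgery_rankOneTensor (w : Fin (m + 1) → Fin (n ^ 2) → F) (u : Fin 3 → Fin (n ^ 2) → F) :
    surgery (rankOneTensor w) (rankOneTensor u) = rankOneTensor (surgeryLeg w u) := by
  funext i
  rw [surgery_apply, rankOneTensor_apply, Fin.prod_univ_castSucc, Fin.prod_univ_castSucc,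
    Fin.prod_univ_castSucc]
  simp only [surgeryLeg, Fin.snoc_castSucc, Fin.snoc_last, rankOneTensor_apply, Fin.prod_univ_three,
    surgeryTri_zero, surgeryTri_one, surgeryTri_two]
  simp only [Fin.prod_univ_castSucc (n := m), surgeryOld_castSucc, surgeryOld_last]
  rw [Finset.mul_sum, Finset.sum_mul, Finset.sum_mul]
  refine Finset.sum_congr rfl fun c _ => ?_
  ring

/-- `(∀ t : Fin 3, P t) ↔ P 0 ∧ P 1 ∧ P 2`. [cite: ChristandlZuiddam2018, Thm. 3.5] -/
theorem forall_fin_three {P : Fin 3 → Prop} : (∀ t, P t) ↔ P 0 ∧ P 1 ∧ P 2 :=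
  ⟨fun h => ⟨h 0, h 1, h 2⟩, fun h t => by fin_cases t; exacts [h.1, h.2.1, h.2.2]⟩

/-- **`T_n(C_{m+3}) = ψ(T_n(C_{m+1}))`**: the surgery of the cycle tensor `T_n(C_{m+1})` against `T_n(C_3)` is the
cycle tensor `T_n(C_{m+3})` (summing out the contracted label `c` forces `c = y_0 = x_{m+2}`).
[cite: ChristandlZuiddam2018, Thm. 3.5] -/
theorem surgery_graphTensor (m n : ℕ) :
    surgery (graphTensor F (cycleSlots (m + 1)) n) (graphTensor F (cycleSlots 3) n) =
      graphTensor F (cycleSlots (m + 3)) n := by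
  classical
  funext i
  rw [surgery_apply, graphTensor_cycleSlots_apply]
  simp_rw [graphTensor_cycleSlots_apply]
  -- name the pair labels of `i`
  set x : Fin (m + 3) → Fin n := fun v => fstLabel n (i v) with hx
  set y : Fin (m + 3) → Fin n := fun v => sndLabel n (i v) with hy
  -- the condition on the `C_{m+1}` factor
  have hA : ∀ c : Fin n, (∀ e : Fin (m + 1), fstLabel n (surgeryOld n i c e) = sndLabel n (surgeryOld n i c (e + 1))) ↔
      ((∀ e : Fin m, x (Fin.castSucc (Fin.castSucc (Fin.castSucc e))) =
          y (Fin.castSucc (Fin.castSucc (Fin.succ e)))) ∧ c = y 0) := by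
    intro c
    rw [Fin.forall_fin_succ']
    simp only [surgeryOld, fstLabel_pairIndex, sndLabel_pairIndex, (Fin.castSucc_lt_last _).ne, if_false, if_true,
      Fin.coeSucc_eq_succ, Fin.last_add_one, Fin.castSucc_zero, hx, hy]
  -- the condition on the `C_3` factor
  have hB : ∀ c : Fin n, (∀ t : Fin 3, fstLabel n (surgeryTri n i c t) = sndLabel n (surgeryTri n i c (t + 1))) ↔
      (x (Fin.castSucc (Fin.castSucc (Fin.last m))) = y (Fin.castSucc (Fin.last (m + 1))) ∧
        x (Fin.castSucc (Fin.last (m + 1))) = y (Fin.last (m + 2)) ∧ x (Fin.last (m + 2)) = c) := by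
    intro c
    rw [forall_fin_three]
    have h0 : (0 : Fin 3) + 1 = 1 := rfl
    have h1 : (1 : Fin 3) + 1 = 2 := rfl
    have h2 : (2 : Fin 3) + 1 = 0 := rfl
    simp only [h0, h1, h2, surgeryTri_zero, surgeryTri_one, surgeryTri_two, fstLabel_pairIndex, sndLabel_pairIndex,
      hx, hy]
  -- the condition on `C_{m+3}`
  have hC : (∀ v : Fin (m + 3), fstLabel n (i v) = sndLabel n (i (v + 1))) ↔
      (((∀ e : Fin m, x (Fin.castSucc (Fin.castSucc (Fin.castSucc e))) =
          y (Fin.castSucc (Fin.castSucc (Fin.succ e)))) ∧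
        x (Fin.castSucc (Fin.castSucc (Fin.last m))) = y (Fin.castSucc (Fin.last (m + 1)))) ∧
        x (Fin.castSucc (Fin.last (m + 1))) = y (Fin.last (m + 2))) ∧ x (Fin.last (m + 2)) = y 0 := by
    rw [Fin.forall_fin_succ', Fin.forall_fin_succ', Fin.forall_fin_succ']
    simp only [Fin.coeSucc_eq_succ, Fin.succ_castSucc, Fin.succ_last, Fin.last_add_one, hx, hy]
  simp_rw [hA, hB]
  rw [if_congr hC rfl rfl]
  -- sum out `c`
  rw [Finset.sum_eq_single (y 0)]
  · by_cases hP : ∀ e : Fin m, x (Fin.castSucc (Fin.castSucc (Fin.castSucc e))) =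
        y (Fin.castSucc (Fin.castSucc (Fin.succ e)))
    · by_cases hQ : x (Fin.castSucc (Fin.castSucc (Fin.last m))) = y (Fin.castSucc (Fin.last (m + 1))) ∧
          x (Fin.castSucc (Fin.last (m + 1))) = y (Fin.last (m + 2)) ∧ x (Fin.last (m + 2)) = y 0
      · rw [if_pos ⟨hP, rfl⟩, if_pos hQ, one_mul, if_pos ⟨⟨⟨hP, hQ.1⟩, hQ.2.1⟩, hQ.2.2⟩]
      · rw [if_neg hQ, mul_zero, if_neg (fun h => hQ ⟨h.1.1.2, h.1.2, h.2⟩)]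
    · rw [if_neg (fun h => hP h.1), zero_mul, if_neg (fun h => hP h.1.1.1)]
  · intro c _ hc
    rw [if_neg (fun h => hc h.2), zero_mul]
  · intro h
    exact absurd (Finset.mem_univ _) h

/-- **[CZ18] Thm. 3.5 with `ℓ = 3`, at the level of ranks: `R(T_n(C_{m+3})) ≤ R(T_n(C_{m+1})) · R(T_n(C_3))`** —
apply `ψ` to an optimal decomposition of `T_n(C_{m+1})`; each simple summand becomes, along an optimal
decomposition of `T_n(C_3)`, a sum of `R(T_n(C_3))` rank-one tensors. [cite: ChristandlZuiddam2018, Thm. 3.5] -/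
theorem tensorRankD_cycleSlots_surgery_le (m n : ℕ) :
    tensorRankD (graphTensor F (cycleSlots (m + 3)) n) ≤
      tensorRankD (graphTensor F (cycleSlots (m + 1)) n) * tensorRankD (graphTensor F (cycleSlots 3) n) := by
  obtain ⟨w, hw⟩ := exists_sum_rankOneTensor_eq_of_tensorRankD_le
    (le_refl (tensorRankD (graphTensor F (cycleSlots (m + 1)) n)))
  obtain ⟨u, hu⟩ := exists_sum_rankOneTensor_eq_of_tensorRankD_le
    (le_refl (tensorRankD (graphTensor F (cycleSlots 3) n)))
  have key : surgery (∑ t, rankOneTensor (w t)) (∑ t, rankOneTensor (u t)) =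
      ∑ a, ∑ b, rankOneTensor (surgeryLeg (w a) (u b)) := by
    rw [surgery_sum_left]
    simp_rw [surgery_sum_right, surgery_rankOneTensor]
  rw [hw, hu, surgery_graphTensor] at key
  rw [key]
  refine (tensorRankD_sum_le _ _).trans ?_
  refine (Finset.sum_le_sum fun a _ => (tensorRankD_sum_le _ _).trans
    (Finset.sum_le_sum fun b _ => tensorRankD_rankOneTensor_le (surgeryLeg (w a) (u b)))).trans ?_
  simp

/-- **`R(T_n(C_{2j+1})) ≤ R(T_n(C_3))^j`** (iterate the surgery from `C_1`, `R(T_n(C_1)) ≤ 1`).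
[cite: ChristandlZuiddam2018, Cor. 3.6] -/
theorem tensorRankD_cycleSlots_odd_le_pow (j n : ℕ) :
    tensorRankD (graphTensor F (cycleSlots (2 * j + 1)) n) ≤ tensorRankD (graphTensor F (cycleSlots 3) n) ^ j := by
  induction j with
  | zero => simpa using tensorRankD_cycleSlots_one_le (F := F) n
  | succ j ih =>
    calc tensorRankD (graphTensor F (cycleSlots (2 * (j + 1) + 1)) n)
        = tensorRankD (graphTensor F (cycleSlots (2 * j + 3)) n) := rfl
      _ ≤ tensorRankD (graphTensor F (cycleSlots (2 * j + 1)) n) * tensorRankD (graphTensor F (cycleSlots 3) n) :=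
          tensorRankD_cycleSlots_surgery_le (2 * j) n
      _ ≤ tensorRankD (graphTensor F (cycleSlots 3) n) ^ j * tensorRankD (graphTensor F (cycleSlots 3) n) :=
          Nat.mul_le_mul_right _ ih
      _ = tensorRankD (graphTensor F (cycleSlots 3) n) ^ (j + 1) := (pow_succ _ _).symm

end Surgery

/-! ## §3 Exponents: `ω(T(C_{2j+1})) ≤ j · ω` ([CZ18] Cor. 3.6; [CVZ19] Thm. 1.1.24) and the discharge -/

section Exponent

variable (F : Type*) [Field F]

/-- An admissible exponent `β` of `T(C_3)` gives the admissible exponent `j · β` of `T(C_{2j+1})`.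
[cite: ChristandlZuiddam2018, Cor. 3.6] -/
theorem mul_mem_graphExponents_cycleSlots_odd (j : ℕ) {β : ℝ} (hβ : β ∈ graphExponents F (cycleSlots 3)) :
    (j : ℝ) * β ∈ graphExponents F (cycleSlots (2 * j + 1)) := by
  rw [mem_graphExponents_iff] at hβ ⊢
  have h3 : ∀ n : ℕ, 0 ≤ (tensorRankD (graphTensor F (cycleSlots 3) n) : ℝ) := fun n => Nat.cast_nonneg _
  have hpow := hβ.pow j
  refine (IsBigO.of_bound 1 (Eventually.of_forall fun n => ?_)).trans (hpow.trans ?_)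
  · rw [one_mul, Real.norm_of_nonneg (Nat.cast_nonneg _), Real.norm_of_nonneg (pow_nonneg (h3 n) _)]
    exact_mod_cast tensorRankD_cycleSlots_odd_le_pow (F := F) j n
  · refine IsBigO.of_bound 1 ?_
    filter_upwards [eventually_ge_atTop 1] with n hn
    have hn' : (0 : ℝ) ≤ n := Nat.cast_nonneg _
    rw [one_mul, Real.norm_of_nonneg (pow_nonneg (Real.rpow_nonneg hn' _) _),
      Real.norm_of_nonneg (Real.rpow_nonneg hn' _), ← Real.rpow_natCast, ← Real.rpow_mul hn', mul_comm]

/-- **[CZ18] Cor. 3.6: `ω(T(C_{2j+1})) ≤ j · ω(T(C_3))`.** [cite: ChristandlZuiddam2018, Cor. 3.6] -/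
theorem graphOmega_cycleSlots_odd_le (j : ℕ) :
    graphOmega F (cycleSlots (2 * j + 1)) ≤ (j : ℝ) * graphOmega F (cycleSlots 3) := by
  refine le_of_forall_gt_imp_ge_of_dense fun γ hγ => ?_
  rcases Nat.eq_zero_or_pos j with rfl | hj
  · have h0 := graphOmega_le_of_mem (cycleSlots_covering (2 * 0 + 1))
      (mul_mem_graphExponents_cycleSlots_odd F 0 (mem_graphExponents_of_lt (cycleSlots_covering 3)
        (lt_add_one (graphOmega F (cycleSlots 3)))))
    simp only [Nat.cast_zero, zero_mul] at h0 hγ ⊢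
    exact h0.trans hγ.le
  · have hj' : (0 : ℝ) < j := by exact_mod_cast hj
    have hβ : graphOmega F (cycleSlots 3) < γ / j := by
      rw [lt_div_iff₀ hj', mul_comm]
      exact hγ
    have h := graphOmega_le_of_mem (cycleSlots_covering (2 * j + 1))
      (mul_mem_graphExponents_cycleSlots_odd F j (mem_graphExponents_of_lt (cycleSlots_covering 3) hβ))
    rwa [mul_div_cancel₀ _ hj'.ne'] at h

/-- **[CVZ19] Thm. 1.1.24, odd cycles, upper bound: `ω(T(C_k)) ≤ (k−1)/2 · ω`** for odd `k` (every field; `ω` =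
the tree's `omega F`). [cite: ChristandlVranaZuiddam2016, Thm. 1.1.24] -/
theorem graphOmega_cycleSlots_le_of_odd (k : ℕ) [NeZero k] (hk : Odd k) :
    graphOmega F (cycleSlots k) ≤ ((k : ℝ) - 1) / 2 * omega F := by
  obtain ⟨j, rfl⟩ := hk
  have h := graphOmega_cycleSlots_odd_le F j
  rw [graphOmega_cycleSlots_three] at h
  have hj : (((2 * j + 1 : ℕ) : ℝ) - 1) / 2 = j := by push_cast; ring
  rw [hj]
  exact h

/-- **Discharge of the named fact `cvz19_thm_1_1_24`** (`GraphTensor.lean`): even cycles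
(`cvz19_thm_1_1_24_even`, flattening + trivial cover), odd lower bound (`cvz19_thm_1_1_24_odd_lower`, parity-cut
flattening) and odd upper bound (`graphOmega_cycleSlots_le_of_odd`, tensor surgery).
[cite: ChristandlVranaZuiddam2016, Thm. 1.1.24] -/
theorem cvz19_thm_1_1_24_holds : cvz19_thm_1_1_24 := by
  intro k _
  exact ⟨fun hk => cvz19_thm_1_1_24_even k hk,
    fun hk => ⟨cvz19_thm_1_1_24_odd_lower k hk, graphOmega_cycleSlots_le_of_odd ℂ k hk⟩⟩

end Exponent

end Literature.Computability.AlgebraicComplexity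

end
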